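import Summits.ValiantsHypothesis.ValiantsHypothesis.Theses.FermionizationDimension
import Summits.ValiantsHypothesis.ValiantsHypothesis.Theorems.FermionizationDimensionSDimPerNotQP
import Summits.ValiantsHypothesis.ValiantsHypothesis.Theorems.ClassTransfer.Negative.SummitHard
import Summits.ValiantsHypothesis.ValiantsHypothesis.Theorems.ClassTransfer.Negative.ConeLevel
import Literature.Computability.AlgebraicComplexity.ValiantClassesProofs
import Literature.Computability.AlgebraicComplexity.ValiantConjectureEquivProofs
import Literature.Computability.AlgebraicComplexity.PermanentVsDeterminant

/-!
# Crux `ClassTransfer` (stmt-ValiantsHypothesis-7287) — DECOMPOSITION CENSUS (crux-strategist,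
# EXEMPT-46 re-exam of the RESTATED deciding crux of route `FermionizationDimension`)

Companion of `Cruxes/ClassTransfer/STRATEGY-CENSUS.md`.  The crux

  `ClassTransfer : ∀ χ (class functions), IsVPFamily (d_χ) → QPRealisable (sgn · χ)`

implies the summit ON ITS OWN (`valiantsHypothesis_of_classTransfer`, Negative/SummitHard.lean,
p157826) and the route's other crux `SDimPerNotQP` is PROVED (`sDimPerNotQP_proof`).  The
BC2-redirect exemption asks for a typed decomposition `X₁ ∧ … ∧ X_k → ClassTransfer` in which no
piece gives the summit `S` (or the crux) on its own and every open piece has a plan.  This file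
records, kernel-checked, why the three possible SHAPES of such a decomposition fail, so that the
census is a theorem schema and not an opinion:

* §1 INSTANCE SPLITS `CTOn Φ ∧ CTOn ¬Φ` (cut the class of coefficient families `χ` by any
  predicate `Φ`): the assembly is trivial (`classTransfer_of_instanceSplit`), but the piece whose
  class contains `χ ≡ 1` proves `S` (`valiantsHypothesis_of_ctOn_one`, via the proved sibling
  `SDimPerNotQP`), and so does the piece whose class contains the 2-fermionant coefficient
  `sgn · 2^{c(σ)}` (`valiantsHypothesis_of_ctOn_fer2`, via the lead's colour-fix kernel bound and
  `Fer₂ ∈ VNP`).  Packaged: `instanceSplit_dichotomy`.  The extreme case `Φ = (· = 1)` is the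
  split "PerTransfer ∧ rest", and `perTransfer_iff_valiantsHypothesis : PerTransfer ↔ S` is the
  landed iff that disqualifies it; `classTransfer_iff_vh_and_rest` displays the crux as
  `S ∧ (decoration)`.
* §2 MODEL / COMPANION SPLITS `SliceIn M ∧ TransferFrom M` ("VP class-function GMFs lie in the
  representation class `M`" + "`M`-members fermionize in quasi-polynomial dimension"): the
  assembly is composition (`classTransfer_of_modelSplit`); the horns are
  `not_transferFrom_of_mem_one/fer2` (if `per ∈ M` or `Fer₂ ∈ M` is known, the transfer piece is
  REFUTED), `valiantsHypothesis_of_sliceIn_of_not_mem_one/fer2` (if `per ∉ M` or `Fer₂ ∉ M` is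
  known — monotone, square-symmetric [Dawar–Wilsenach, ToC 21 (2025)], ordered set-multilinear —
  the collapse piece proves `S`), `valiantsHypothesis_of_transferFrom_of_sliceIn` (if `VP ⊆ M` is
  known — `M = VQP`, qp formulas / qp determinants by VSBR, depth-4 `n^{O(√n)}` — the transfer
  piece proves `S`; instance `transferFromVQP_summit_hard`).  Packaged: `modelSplit_dichotomy`.
* §3 THE ONLY (c)-SURVIVORS: `M` a POLYNOMIAL-size syntactic class with all of `VP ⊆ M`,
  `per ∈ M`, `per ∉ M`, `Fer₂ ∈ M`, `Fer₂ ∉ M` open — `M = VBP` (p-bounded determinantal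
  complexity) is typed here (`SliceInVBP`, `DetTransfer`, assembly `classTransfer_of_vbpSplit`).
  Its transfer piece carries, at `χ ≡ 1`, exactly Valiant's permanent-versus-determinant
  conjecture (`dcPerSuperpolynomial_of_detTransfer : DetTransfer → DcPerSuperpolynomialComplex`,
  Landsberg 2017 Conj. 1.2.4.2) and its collapse piece is, at `χ ≡ 1`, "per ∈ VP → dc(per) poly"
  (`sliceInVBP_at_one`): the split is the folklore factorisation
  `VP ≠ VNP ⇐ (VBP ≠ VNP) ∧ (per ∈ VP → per ∈ VBP)` dressed over Schur's slice, with no plan on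
  either side — it fails (d), and is recorded, not filed.

No new definitions enter the tree (this is a crux workfile); everything is stated over the route
file, the landed Negative theorems and `Literature.Computability.AlgebraicComplexity`.
-/

set_option linter.dupNamespace false
set_option linter.unusedVariables false

noncomputable section

namespace Summit.ValiantsHypothesis.ValiantsHypothesis.Cruxes.ClassTransfer.Census

open Equiv Finset
open Literature.Computability.AlgebraicComplexity
open Summit.ValiantsHypothesis.ValiantsHypothesis.Theses.FermionizationDimension
open Summit.ValiantsHypothesis.ValiantsHypothesis.Theorems.ClassTransfer.Negative

/-! ## §0 Vocabulary (abbreviations only) -/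

/-- Coefficient families `χ = (χ_n : S_n → ℂ)_n`. -/
abbrev Coeff : Type := (n : ℕ) → Perm (Fin n) → ℂ

/-- The generalized-matrix-function family `d_χ = (Σ_σ χ_n(σ) ∏_i x_{σ(i),i})_n` of `χ`. -/
abbrev gmf (χ : Coeff) : (n : ℕ) → MvPolynomial (Fin n × Fin n) ℂ :=
  fun n => ∑ σ : Perm (Fin n), MvPolynomial.C (χ n σ) * ∏ i : Fin n, MvPolynomial.X (σ i, i)

/-- `χ` is a family of class functions. -/
abbrev IsClassFn (χ : Coeff) : Prop :=
  ∀ n (σ τ : Perm (Fin n)), IsConj σ τ → χ n σ = χ n τ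

/-- Quasi-polynomial commutative realisability of the sgn-twist of `χ` (the conclusion of the
crux, verbatim). -/
def QPRealisable (χ : Coeff) : Prop :=
  ∃ s : ℕ → ℕ, IsQPBounded s ∧ ∀ n : ℕ,
    ∃ (R : Type) (_ : CommRing R) (_ : Algebra ℂ R) (_ : Module.Finite ℂ R)
      (u : Fin n → Fin n → R) (ℓ : R →ₗ[ℂ] ℂ),
      Module.finrank ℂ R ≤ s n ∧
        ∀ σ : Perm (Fin n), ℓ (∏ i, u (σ i) i) = ((Perm.sign σ : ℤ) : ℂ) * χ n σ

/-- The crux in this vocabulary (definitional). -/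
theorem classTransfer_iff :
    ClassTransfer ↔ ∀ χ : Coeff, IsClassFn χ → IsVPFamily (gmf χ) → QPRealisable χ :=
  Iff.rfl

/-- The two witnesses that make every cut summit-hard: `χ ≡ 1` (the permanent) … -/
abbrev one : Coeff := fun _ _ => 1

/-- … and the 2-fermionant coefficient `sgn(σ) · 2^{c(σ)}` (`2^{c(σ)} = #{f : [n] → [2] | f ∘ σ = f}`). -/
abbrev fer2 : Coeff := fun n σ =>
  ((Perm.sign σ : ℤ) : ℂ) * ((univ.filter fun f : Fin n → Fin 2 => ∀ x, f (σ x) = f x).card : ℂ)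

theorem one_isClassFn : IsClassFn one := fun _ _ _ _ => rfl

theorem fer2_isClassFn : IsClassFn fer2 := fun n σ τ h => colourFix_isClassFunction 0 n σ τ h

/-- `d_1 = per`. [folklore] -/
theorem gmf_one : gmf one = fun n => perPoly (Fin n) ℂ := by
  funext n
  show (∑ σ : Perm (Fin n), MvPolynomial.C (1 : ℂ) * ∏ i : Fin n, MvPolynomial.X (σ i, i)) =
    perPoly (Fin n) ℂ
  simp [perPoly, Matrix.permanent, Matrix.mvPolynomialX]

/-- `VP = VNP` puts the permanent GMF family in `VP`. [folklore] -/
theorem isVPFamily_gmf_one_of_eq (hEq : VP ℂ = VNP ℂ) : IsVPFamily (gmf one) := by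
  rw [gmf_one]
  have hVNP := perFamily_mem_VNP_holds ℂ
  have hVP : perFamily ℂ ∈ VP ℂ := by rw [hEq]; exact hVNP
  exact (mem_VP_ofFintype_iff_holds _).1 hVP

/-- `VP = VNP` puts the 2-fermionant family in `VP` (`isVNPFamily_fermionant_two`). [folklore] -/
theorem isVPFamily_gmf_fer2_of_eq (hEq : VP ℂ = VNP ℂ) : IsVPFamily (gmf fer2) := by
  have hVNP : PolyFamily.ofFintype (gmf fer2) ∈ VNP ℂ :=
    (mem_VNP_ofFintype_iff_holds _).2 isVNPFamily_fermionant_two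
  have hVP : PolyFamily.ofFintype (gmf fer2) ∈ VP ℂ := by rw [hEq]; exact hVNP
  exact (mem_VP_ofFintype_iff_holds _).1 hVP

/-- `sgn · 1` is NOT qp-realisable — the proved sibling crux `SDimPerNotQP`. [folklore] -/
theorem not_qpRealisable_one : ¬ QPRealisable one := by
  rintro ⟨s, hs, hreal⟩
  obtain ⟨n, hn⟩ := Summit.ValiantsHypothesis.ValiantsHypothesis.Theorems.sDimPerNotQP_proof s hs
  obtain ⟨R, _, _, _, u, ℓ, hdim, hu⟩ := hreal n
  have hlt : s n < Module.finrank ℂ R := hn R u ℓ (fun σ => by rw [hu σ, mul_one])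
  omega

/-- `sgn · fer2 = 2^{c}` is NOT qp-realisable — the lead's colour-fix kernel bound. [folklore] -/
theorem not_qpRealisable_fer2 : ¬ QPRealisable fer2 := not_qpRealisable_colourFix 0

/-- Under `VP = VNP` the crux's hypothesis holds at both witnesses while its conclusion fails
at both: this is the whole mechanism of `ClassTransfer → S`. [folklore] -/
theorem valiantsHypothesis_of_qpRealisable_one (h : IsVPFamily (gmf one) → QPRealisable one) :
    _root_.ValiantsHypothesis := by
  show VP ℂ ≠ VNP ℂ
  intro hEq
  exact not_qpRealisable_one (h (isVPFamily_gmf_one_of_eq hEq))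

theorem valiantsHypothesis_of_qpRealisable_fer2 (h : IsVPFamily (gmf fer2) → QPRealisable fer2) :
    _root_.ValiantsHypothesis := by
  show VP ℂ ≠ VNP ℂ
  intro hEq
  exact not_qpRealisable_fer2 (h (isVPFamily_gmf_fer2_of_eq hEq))

/-! ## §1 Instance splits: cut the class of `χ` by a predicate `Φ` -/

/-- The crux restricted to the coefficient families satisfying `Φ`. -/
def CTOn (Φ : Coeff → Prop) : Prop :=
  ∀ χ : Coeff, Φ χ → IsClassFn χ → IsVPFamily (gmf χ) → QPRealisable χ

/-- (b) holds trivially for every instance split. [folklore] -/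
theorem classTransfer_of_instanceSplit (Φ : Coeff → Prop)
    (h₁ : CTOn Φ) (h₂ : CTOn fun χ => ¬ Φ χ) : ClassTransfer := by
  intro χ hcl hVP
  by_cases h : Φ χ
  · exact h₁ χ h hcl hVP
  · exact h₂ χ h hcl hVP

/-- Each piece is implied by the crux (so no piece is stronger than the crux). [folklore] -/
theorem ctOn_of_classTransfer (Φ : Coeff → Prop) (h : ClassTransfer) : CTOn Φ :=
  fun χ _ hcl hVP => h χ hcl hVP

/-- (c) FAILS, horn 1: the piece whose class contains `χ ≡ 1` proves the summit by itself
(through the proved `SDimPerNotQP`). [folklore] -/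
theorem valiantsHypothesis_of_ctOn_one (Φ : Coeff → Prop) (hΦ : Φ one) (h : CTOn Φ) :
    _root_.ValiantsHypothesis :=
  valiantsHypothesis_of_qpRealisable_one (h one hΦ one_isClassFn)

/-- (c) FAILS, horn 2: the piece whose class contains the 2-fermionant coefficient proves the
summit by itself (through the lead's `Fermionant.lean` / `FermionantVNP.lean`). [folklore] -/
theorem valiantsHypothesis_of_ctOn_fer2 (Φ : Coeff → Prop) (hΦ : Φ fer2) (h : CTOn Φ) :
    _root_.ValiantsHypothesis :=
  valiantsHypothesis_of_qpRealisable_fer2 (h fer2 hΦ fer2_isClassFn)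

/-- **Instance-split dichotomy.** For EVERY predicate `Φ` one of the two pieces of the split
`CTOn Φ ∧ CTOn ¬Φ` implies the summit on its own (which one is decided by `Φ 1`). The same holds
for any finite cover `Φ₁ ∨ … ∨ Φ_k` of the class functions: the piece containing `χ ≡ 1` is
summit-hard (`valiantsHypothesis_of_ctOn_one`). [folklore] -/
theorem instanceSplit_dichotomy (Φ : Coeff → Prop) :
    (CTOn Φ → _root_.ValiantsHypothesis) ∨
      (CTOn (fun χ => ¬ Φ χ) → _root_.ValiantsHypothesis) := by
  by_cases h : Φ one
  · exact Or.inl (valiantsHypothesis_of_ctOn_one Φ h)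
  · exact Or.inr (valiantsHypothesis_of_ctOn_one (fun χ => ¬ Φ χ) h)

/-- The extreme instance split (decomposition D2 of the census): the `χ ≡ 1` instance of the
crux, i.e. the only instance the route's deciding theorem `closes` ever uses. -/
def PerTransfer : Prop :=
  IsVPFamily (gmf one) → QPRealisable one

/-- **The landed iff that disqualifies D2:** `PerTransfer ↔ ValiantsHypothesis`.
(`→`: `SDimPerNotQP`; `←`: `VP ≠ VNP` makes the hypothesis `per ∈ VP` absurd —
`isPComputable_perPoly_complex_iff`, von zur Gathen 1987 Prop. 4.8.) [folklore] -/
theorem perTransfer_iff_valiantsHypothesis : PerTransfer ↔ _root_.ValiantsHypothesis := by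
  constructor
  · exact valiantsHypothesis_of_qpRealisable_one
  · intro hVH hVP
    exfalso
    apply (show VP ℂ ≠ VNP ℂ from hVH)
    rw [gmf_one] at hVP
    exact isPComputable_perPoly_complex_iff.1 hVP.2

/-- The crux displayed as "summit ∧ decoration": `ClassTransfer ↔ S ∧ CTOn (· ≠ 1)`.  The
second conjunct is everything the crux says about class functions other than `1`; none of it is
on the path to `S`. [folklore] -/
theorem classTransfer_iff_vh_and_rest :
    ClassTransfer ↔ _root_.ValiantsHypothesis ∧ CTOn (fun χ => χ ≠ one) := by
  constructor
  · exact fun h => ⟨valiantsHypothesis_of_classTransfer h, ctOn_of_classTransfer _ h⟩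
  · rintro ⟨hVH, hrest⟩
    refine classTransfer_of_instanceSplit (fun χ => χ ≠ one) hrest ?_
    intro χ hχ hcl hVP
    have hχ1 : χ = one := by
      by_contra h'
      exact hχ h'
    subst hχ1
    exact perTransfer_iff_valiantsHypothesis.2 hVH hVP

/-! ## §2 Model / companion splits: factor through a representation class `M` -/

/-- Collapse piece: `VP` class-function GMF families lie in the class `M`. -/
def SliceIn (M : Coeff → Prop) : Prop :=
  ∀ χ : Coeff, IsClassFn χ → IsVPFamily (gmf χ) → M χ

/-- Transfer piece: members of `M` (class functions) fermionize in qp dimension. -/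
def TransferFrom (M : Coeff → Prop) : Prop :=
  ∀ χ : Coeff, IsClassFn χ → M χ → QPRealisable χ

/-- (b) holds trivially for every model split (composition). [folklore] -/
theorem classTransfer_of_modelSplit (M : Coeff → Prop) (hP : SliceIn M) (hQ : TransferFrom M) :
    ClassTransfer :=
  fun χ hcl hVP => hQ χ hcl (hP χ hcl hVP)

/-- Horn A: if `per ∈ M` is known, the transfer piece is REFUTED. [folklore] -/
theorem not_transferFrom_of_mem_one (M : Coeff → Prop) (h : M one) : ¬ TransferFrom M :=
  fun hQ => not_qpRealisable_one (hQ one one_isClassFn h)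

/-- Horn A′: if `Fer₂ ∈ M` is known, the transfer piece is REFUTED. [folklore] -/
theorem not_transferFrom_of_mem_fer2 (M : Coeff → Prop) (h : M fer2) : ¬ TransferFrom M :=
  fun hQ => not_qpRealisable_fer2 (hQ fer2 fer2_isClassFn h)

/-- Horn B: if `per ∉ M` is known (monotone circuits; square-symmetric circuits,
Dawar–Wilsenach 2025; ordered set-multilinear ABPs, Nisan 1991), the collapse piece proves the
summit on its own. [folklore] -/
theorem valiantsHypothesis_of_sliceIn_of_not_mem_one (M : Coeff → Prop) (h : ¬ M one)
    (hP : SliceIn M) : _root_.ValiantsHypothesis := by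
  show VP ℂ ≠ VNP ℂ
  intro hEq
  exact h (hP one one_isClassFn (isVPFamily_gmf_one_of_eq hEq))

/-- Horn B′: if `Fer₂ ∉ M` is known, the collapse piece proves the summit on its own. [folklore] -/
theorem valiantsHypothesis_of_sliceIn_of_not_mem_fer2 (M : Coeff → Prop) (h : ¬ M fer2)
    (hP : SliceIn M) : _root_.ValiantsHypothesis := by
  show VP ℂ ≠ VNP ℂ
  intro hEq
  exact h (hP fer2 fer2_isClassFn (isVPFamily_gmf_fer2_of_eq hEq))

/-- Horn C: if the collapse `VP-slice ⊆ M` is itself KNOWN (a theorem `hP`), the transfer piece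
proves the summit on its own. [folklore] -/
theorem valiantsHypothesis_of_transferFrom_of_sliceIn (M : Coeff → Prop) (hP : SliceIn M)
    (hQ : TransferFrom M) : _root_.ValiantsHypothesis :=
  valiantsHypothesis_of_classTransfer (classTransfer_of_modelSplit M hP hQ)

/-- **Model-split dichotomy** (the lead's oblivious-split dichotomy, restated for representation
classes, with `SDimPerNotQP` now a theorem): for EVERY class `M`, either the transfer piece is
false or the collapse piece implies the summit — decided by `per ∈ M`.  So a model split can have
two honest open pieces only while `per ∈ M` is UNDECIDED (and, by horns A′/B′/C, while
`Fer₂ ∈ M` and `VP-slice ⊆ M` are undecided too). [folklore] -/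
theorem modelSplit_dichotomy (M : Coeff → Prop) :
    ¬ TransferFrom M ∨ (SliceIn M → _root_.ValiantsHypothesis) := by
  by_cases h : M one
  · exact Or.inl (not_transferFrom_of_mem_one M h)
  · exact Or.inr (valiantsHypothesis_of_sliceIn_of_not_mem_one M h)

/-- Decomposition D3 of the census (hypothesis class `VQP`; companion `VP ⊆ VQP` is a theorem,
`IsVPFamily.isVQPFamily`): its collapse piece HOLDS … [folklore] -/
theorem sliceIn_VQP : SliceIn fun χ => IsVQPFamily (gmf χ) :=
  fun χ _ h => h.isVQPFamily

/-- … hence its transfer piece ("every VQP class-function GMF family fermionizes in qp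
dimension", the natural weakening of the hypothesis that VSBR-type normal forms suggest) is
summit-hard on its own: (c) fails. The same verdict holds verbatim for every `M` with a proved
companion `VP ⊆ M` (qp formulas, qp determinants, depth-4 of size `n^{O(√n)}`). [folklore] -/
theorem transferFromVQP_summit_hard (hQ : TransferFrom fun χ => IsVQPFamily (gmf χ)) :
    _root_.ValiantsHypothesis :=
  valiantsHypothesis_of_transferFrom_of_sliceIn _ sliceIn_VQP hQ

/-! ## §3 The best typed split surviving (c): `M = VBP` (p-bounded determinantal complexity) -/

/-- `d_χ` has polynomially bounded (affine) determinantal complexity — membership of the GMF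
family in `VBP = VP_ws` (Toda / Malod–Portier), typed with
`Literature.Computability.AlgebraicComplexity.determinantalComplexity`. -/
def InVBP (χ : Coeff) : Prop :=
  IsPBounded fun n => determinantalComplexity (gmf χ n)

/-- Piece X₁ of D4 ("slice collapse"): every `VP` family of class-function GMFs has polynomially
bounded determinantal complexity — `VP = VBP` on Schur's slice. Open; no approach known; at
`χ ≡ 1` it reads `per ∈ VP → dc(per) p-bounded` (`sliceInVBP_at_one`). -/
def SliceInVBP : Prop := SliceIn InVBP

/-- Piece X₂ of D4 ("determinantal transfer", the lead's suggested shape "consume a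
determinantal representation"): every class-function GMF family of p-bounded determinantal
complexity has `sgn · χ` realisable in qp dimension. Open; no mechanism known (a generic affine
representation of size `m` fermionizes only over the even Clifford algebra on `2m` generators,
dimension `C(2m, ≤ 2n)`); at `χ ≡ 1` it is Valiant's permanent-versus-determinant conjecture
(`dcPerSuperpolynomial_of_detTransfer`). -/
def DetTransfer : Prop := TransferFrom InVBP

/-- (b) for D4: the assembly, proved (trivial seam). [folklore] -/
theorem classTransfer_of_vbpSplit (h₁ : SliceInVBP) (h₂ : DetTransfer) : ClassTransfer :=
  classTransfer_of_modelSplit InVBP h₁ h₂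

/-- What X₂ really is at `χ ≡ 1`: **`DetTransfer → dc(per_n)` is not polynomially bounded**
(`DcPerSuperpolynomialComplex`, Valiant 1979 / Landsberg 2017 Conj. 1.2.4.2 — "Valiant's
hypothesis in determinantal-complexity form"). So X₂ is at least the permanent-versus-determinant
problem: not the summit `VP ≠ VNP` by the letter (it is implied by it), but the neighbouring form
of it. [folklore] -/
theorem dcPerSuperpolynomial_of_detTransfer (h₂ : DetTransfer) : DcPerSuperpolynomialComplex := by
  intro hP
  apply not_qpRealisable_one
  refine h₂ one one_isClassFn ?_
  show IsPBounded fun n => determinantalComplexity (gmf one n)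
  rw [gmf_one]
  exact hP

/-- What X₂ says at the fermionant: `DetTransfer → dc(Fer₂,n)` is not polynomially bounded —
an explicit `VNP` family outside `VBP`, i.e. `VBP ≠ VNP` again. [folklore] -/
theorem not_inVBP_fer2_of_detTransfer (h₂ : DetTransfer) : ¬ InVBP fer2 :=
  fun h => not_qpRealisable_fer2 (h₂ fer2 fer2_isClassFn h)

/-- What X₁ says at `χ ≡ 1`: `per ∈ VP → dc(per)` p-bounded — the `VP` versus `VBP` question
for the permanent (vacuous under the summit). [folklore] -/
theorem sliceInVBP_at_one (h₁ : SliceInVBP) :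
    IsVPFamily (fun n => perPoly (Fin n) ℂ) →
      IsPBounded fun n => determinantalComplexity (perPoly (Fin n) ℂ) := by
  intro hVP
  have hmem : InVBP one := h₁ one one_isClassFn (by rw [gmf_one]; exact hVP)
  have h' : IsPBounded fun n => determinantalComplexity (gmf one n) := hmem
  rw [gmf_one] at h'
  exact h'

/-- D4 is the folklore factorisation in costume: its two pieces give the summit exactly through
"(VBP-form of VH) ∧ (VP → VBP for the permanent)". [folklore] -/
theorem valiantsHypothesis_of_vbpSplit (h₁ : SliceInVBP) (h₂ : DetTransfer) :
    _root_.ValiantsHypothesis :=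
  valiantsHypothesis_of_classTransfer (classTransfer_of_vbpSplit h₁ h₂)

end Summit.ValiantsHypothesis.ValiantsHypothesis.Cruxes.ClassTransfer.Census

end
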